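import Literature.NumberTheory.EllipticCurves.SkinnerUrban2014.SemistableCurvesProofs
import Literature.NumberTheory.EllipticCurves.AdditiveReductionRamifiedTorsionProofs
import Literature.NumberTheory.EllipticCurves.RootNumberTwistProofs
import HarnessLib

/-!
# Level lowering of `E[p]` at an odd prime `p` of GOOD reduction: the level-lowered newform, and
# the additive primes of `E` divide its level (Ribet 1990 / Diamond 1995, for elliptic curves)

`Proofs` file (theorems only: no definition, no named fact, no instance, no `sorry`), topic
`NumberTheory/EllipticCurves`.  For an elliptic curve `E/ℚ`, an ODD prime `p` of GOOD reduction with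
`E[p]` irreducible, and a framed model `ρ̄` of `E[p]` (`W.IsTorsionGaloisRep p ρ̄`), write
`ρ̄' = ρ̄ ⊗ 𝔽̄_p`.  Granted, BY NAME, the Modularity Theorem (`exists_isNewformOf`, BCDT Thm. A) and
Diamond's refined level lowering (`diamond1995_refinedSerre` = Ribet 1990 Thm. 1.1 + Carayol +
Edixhoven + Diamond 1995 Thm. 1.1, `ℓ` odd), this file proves:

* §1 (number fields) `WeierstrassCurve.IsTorsionGaloisRep.exists_mem_inertia_apply_ne_one_of_hasAdditiveReductionAt`
  — **`ρ̄_{E,p}` is RAMIFIED at every additive place `v ∤ p`, `p ≥ 3`, in the framed / global-inertia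
  sense**: some `σ` in the inertia group `I_𝔓 ≤ Γ_K` of some prime `𝔓 ∣ v` of `\bar ℤ_K` has
  `ρ̄(σ) ≠ 1`.  (The tree had the local form — a local inertia element moves a `p`-torsion point of
  `E(K̄_v)`, `exists_inertia_smul_ne_of_hasAdditiveReductionAt`, Silverman *AEC* VII.6.1 / proof of
  VII.7.1 — and its unframed global shadow `exists_smul_geomTorsion_ne_of_hasAdditiveReductionAt`;
  here the local inertia element is restricted into `I_{𝔓_{ι,𝔐}}` along the chosen embedding
  `ι : K̄ → K̄_v`, `resGalOfEmb_mem_inertia_primeBelow`, Neukirch II (9.6).)  Corollaries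
  `…not_isUnramifiedAt_of_hasAdditiveReductionAt` and, after an injective change of coefficients,
  `…not_isUnramifiedAt_baseChange_of_hasAdditiveReductionAt`.
* §2 (`K = ℚ`) `WeierstrassCurve.dvd_of_isGaloisRepOfNewform1Int_of_hasAdditiveReductionAt` — **an
  additive prime `q ≠ p` of `E` (`p ≥ 3`) divides the level `M` of ANY newform `f ∈ S_k(Γ₁(M))`
  carrying `ρ̄ ⊗ K'` away from `M p`** (`IsGaloisRepOfNewform1Int f ι_f {ℓ ∣ M p} (ρ̄ ⊗ K')` contains
  "unramified off `M p`").
* §3 (`K = ℚ`) `WeierstrassCurve.exists_isNewform1_two_dvd_serreLevel_of_hasGoodReductionAtPrime` —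
  **THE LEVEL-LOWERED NEWFORM**: `p` odd, `E` good at `p`, `E[p]` irreducible ⟹ there is a level
  `M ∣ N(ρ̄')` (Serre's prime-to-`p` level `serreLevel p ρ̄'`), `p ∤ M`, every prime factor of `M` a
  prime of BAD reduction of `E`, every ADDITIVE prime `q ≠ p` of `E` dividing `M`, and a newform
  `f ∈ S₂(Γ₁(M))` with `ρ̄' ≅ ρ̄_f` (`IsGaloisRepOfNewform1Int f ι_f {ℓ ∣ M p} ρ̄'`).  Proof = Steps
  1–4 of the tree's `SkinnerUrban2014.ram_of_semistable_of_irr` (Serre's road for a semistable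
  curve) for a GENERAL curve: `ρ̄'` is irreducible (`isAbsolutelyIrreducible_of_hasIrreducibleModPGaloisRep`),
  odd (`det = χ̄_p`), modular (`IsModular.isModular_of_isTorsionGaloisRep''`), of Serre weight `2`
  at the canonical datum above `p` (`serreWeight_eq_two_of_hasGoodReductionAt`: good ordinary AND
  good supersingular, `p ≠ 2`); Diamond's fact gives `f`; §2 and
  `not_dvd_serreLevel_baseChange_of_hasGoodReductionAt_int` place the primes.
* §4 `…exists_isNewform0_two_dvd_serreLevel_of_hasGoodReductionAtPrime_of_not_dvd_totient` — the
  `Γ₀(M)` form when `p ∤ φ(M)` (then the nebentypus, `≡ 1 (mod 𝔓)` at the good primes, is trivial: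
  `nebentypus_eq_one_of_forall_prime`, `exists_isNewform0_coe_eq_of_nebentypus_eq_one`).

Existing neighbours (not restated): `SkinnerUrban2014.ram_of_semistable_of_irr` (E SEMISTABLE: the
level is `1`, contradiction), `Summit.….NonSurjCornerSerreLevel.exists_newform_two_of_not_ram_of_dvd`
(`p ≥ 5` MULTIPLICATIVE at `p`, peu ramifié).  The present door is the case "`p` GOOD, additive primes
elsewhere" — e.g. `p = 3` supersingular with `a₃ = 0` and a tame potentially good prime `q` of Kodaira
type `IV`/`IV*` (line `shadow_seed` of crux `KobayashiLowerHalfLargeImage`, item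
stmt-BirchSwinnertonDyer-19001, cell `bsd-ssimc`: the first link "Ribet–Diamond gives the newform `g`
of weight `2` and level `M ∣ N(ρ̄)` with `q ∣ M`" of its composite binder; the EXPONENT `q ∥ N(ρ̄)` is
the sibling `ArtinExponentThreeTorsionOfTamagawaProofs`; the trivial character at `ℓ = 3` (Carayol) is
NOT claimed here beyond §4).  HONEST FRAMING: conditional on the two named facts displayed as
hypotheses; nothing here proves any crux or summit statement; BSD is proved for no curve.

## References

* [Ribet1990] K. A. Ribet, *On modular representations of Gal(ℚ̄/ℚ) arising from modular forms*,
  Invent. Math. 100 (1990), 431–476, Thm. 1.1.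
* [Diamond1995RefinedSerre] F. Diamond, *The refined conjecture of Serre*, in: Elliptic Curves,
  Modular Forms & Fermat's Last Theorem (Hong Kong 1993), International Press (1995), 22–37, Thm. 1.1.
* [Serre1987] J.-P. Serre, Duke Math. J. 54 (1987), §1.2 (`N(ρ)`), §2.8 Prop. 3–4 (`k(ρ) = 2` at a
  good prime), §4.6 (Lemme 5, Théorème 4).
* [SilvermanAEC2009] J. H. Silverman, *The Arithmetic of Elliptic Curves*, 2nd ed., Thm. VII.6.1 and
  proof of Thm. VII.7.1 (additive reduction ⇒ `E[p]` ramified, `p ≥ 3`).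
* [NeukirchANT1999] J. Neukirch, *Algebraic Number Theory*, Ch. II (8.1), (9.6).
* [BCDTJAMS2001] C. Breuil, B. Conrad, F. Diamond, R. Taylor, J. Amer. Math. Soc. 14 (2001), Thm. A.

## Design

Theorems only; `noncomputable section`; one universe `u` (number-field part).  The ℚ-part follows
the binders of `SkinnerUrban2014.SemistableCurvesProofs` / `ErratumRoadFive…SerreLevel` verbatim
(`[TopologicalSpace (AlgebraicClosure (ZMod p))] [DiscreteTopology …]` supplied by the caller, the
change of coefficients `algebraMap (ZMod p) (AlgebraicClosure (ZMod p))`).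
-/

noncomputable section

open scoped Classical MatrixGroups ModularForm NumberField NNReal
open CongruenceSubgroup Polynomial

universe u

namespace WeierstrassCurve

open Literature.NumberTheory Literature.NumberTheory.GaloisRepresentations
  Literature.NumberTheory.EllipticCurves Literature.NumberTheory.EllipticCurves.ModularForms
  Rat.HeightOneSpectrum IsDedekindDomain IsDedekindDomain.HeightOneSpectrum Field NumberField
  Literature.NumberTheory.Automorphic Literature.NumberTheory.Automorphic.BCDT
  Literature.NumberTheory.DiophantineGeometry Literature.NumberTheory.EllipticCurves.Rank1Residual
  Literature.NumberTheory.GaloisRepresentations.ModPGaloisRep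
  Literature.NumberTheory.GaloisRepresentations.IsNonarchimedeanLocalField
  Literature.NumberTheory.EllipticCurves.SkinnerUrban2014 ValuativeRel

/-! ### §1 `E[p]` is ramified at an additive place `v ∤ p`, `p ≥ 3` — framed, global inertia -/

section Ramified

variable {K : Type u} [Field K] [NumberField K] {W : WeierstrassCurve K}

/-- **`ρ̄_{E,p}` is ramified at an additive `v ∤ p`, `p ≥ 3` (framed form, global inertia).**  For
`E/K` elliptic over a number field, `v` a finite place of ADDITIVE reduction, `p ≥ 3` a prime with
`v ∤ p`, and a framed model `ρ̄ : Γ_K →ₜ* GL₂(𝔽_p)` of `E[p]` (`W.IsTorsionGaloisRep p ρ̄`): there are a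
prime `𝔓 ∣ v` of `\bar ℤ_K` and `σ ∈ I_𝔓 ≤ Γ_K` with `ρ̄(σ) ≠ 1`.  Proof: a local inertia element
`τ ∈ I_𝔐 ≤ Γ_{K_v}` moves a `p`-torsion point `Q ∈ E(K̄_v)` (Silverman *AEC* VII.6.1 / VII.7.1,
tree `exists_inertia_smul_ne_of_hasAdditiveReductionAt`); `Q = ι_* P₀` for the chosen embedding
`ι : K̄ → K̄_v` and some `P₀ ∈ E[p]` (`exists_pointsMapOfEmb_eq_of_nsmul_eq_zero`); `σ = res_ι τ` lies
in `I_{𝔓_{ι,𝔐}}` (Neukirch II (9.6), `resGalOfEmb_mem_inertia_primeBelow`) and moves `P₀`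
(equivariance `pointsMapOfEmb_smul`), so `ρ̄(σ) ≠ 1` (the frame is injective).
[cite: SilvermanAEC2009, Thm. VII.6.1 and proof of Thm. VII.7.1 (PDF pp. 177–179)]
[cite: NeukirchANT1999, Ch. II §9 Prop. (9.6)] -/
theorem IsTorsionGaloisRep.exists_mem_inertia_apply_ne_one_of_hasAdditiveReductionAt [W.IsElliptic]
    {v : HeightOneSpectrum (𝓞 K)} (hadd : W.HasAdditiveReductionAt v) {p : ℕ} [hp : Fact p.Prime]
    (hp3 : 3 ≤ p) (hpv : (p : 𝓞 K) ∉ v.asIdeal) {ρ : FramedGaloisRep K (ZMod p) 2}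
    (hρ : W.IsTorsionGaloisRep p ρ) :
    ∃ 𝔓 ∈ v.primesAbove, ∃ σ ∈ 𝔓.inertia (absoluteGaloisGroup K), ρ σ ≠ 1 := by
  obtain ⟨w, hw⟩ := v.exists_spectralValuation
  obtain ⟨𝔐, h𝔐⟩ := v.localPrimesAbove_nonempty
  obtain ⟨τ, hτ, Q, hpQ, hτQ⟩ :=
    W.exists_inertia_smul_ne_of_hasAdditiveReductionAt hadd hp.out hp3 hpv hw h𝔐
  set ι : AlgebraicClosure K →ₐ[K] AlgebraicClosure (v.adicCompletion K) :=
    closureEmb (K := K) (v.adicCompletion K) with hι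
  obtain ⟨P₀, hpP₀, hP₀Q⟩ :=
    exists_pointsMapOfEmb_eq_of_nsmul_eq_zero W ι hp.out.ne_zero hpQ
  refine ⟨v.primeBelow ι 𝔐, primeBelow_mem_primesAbove (ι := ι) h𝔐, resGalOfEmb ι τ,
    v.resGalOfEmb_mem_inertia_primeBelow ι 𝔐 hτ, fun h1 ↦ hτQ ?_⟩
  -- `ρ̄(σ) = 1` forces `σ` to fix `E[p]` pointwise, in particular `P₀`
  have hmem : P₀ ∈ geomTorsion W (p : ℤ) :=
    (Submodule.mem_torsionBy_iff _ _).mpr (show (p : ℤ) • P₀ = 0 by rw [natCast_zsmul, hpP₀])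
  obtain ⟨e, he⟩ := hρ
  have hfix : resGalOfEmb ι τ • (⟨P₀, hmem⟩ : geomTorsion W (p : ℤ)) = ⟨P₀, hmem⟩ := by
    apply e.injective
    rw [he, h1]
    simp
  have h' := congrArg
    (fun R : geomTorsion W (p : ℤ) ↦ pointsMapOfEmb W ι (R : geomPoints W)) hfix
  simp only [Literature.NumberTheory.EllipticCurves.AddSubgroup.torsionBy.coe_smul,
    pointsMapOfEmb_smul] at h'
  rw [← hP₀Q]
  exact h'

/-- **`ρ̄_{E,p}` is NOT unramified at an additive `v ∤ p`, `p ≥ 3`** (`FramedGaloisRep.IsUnramifiedAt`: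
every inertia group above `v` maps to `1`) — the negation of the framed unramifiedness predicate,
from `exists_mem_inertia_apply_ne_one_of_hasAdditiveReductionAt`.
[cite: SilvermanAEC2009, Thm. VII.6.1 and proof of Thm. VII.7.1 (PDF pp. 177–179)] -/
theorem IsTorsionGaloisRep.not_isUnramifiedAt_of_hasAdditiveReductionAt [W.IsElliptic]
    {v : HeightOneSpectrum (𝓞 K)} (hadd : W.HasAdditiveReductionAt v) {p : ℕ} [Fact p.Prime]
    (hp3 : 3 ≤ p) (hpv : (p : 𝓞 K) ∉ v.asIdeal) {ρ : FramedGaloisRep K (ZMod p) 2}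
    (hρ : W.IsTorsionGaloisRep p ρ) : ¬ ρ.IsUnramifiedAt v := by
  intro hunr
  obtain ⟨𝔓, h𝔓, σ, hσ, hne⟩ :=
    hρ.exists_mem_inertia_apply_ne_one_of_hasAdditiveReductionAt hadd hp3 hpv
  exact hne (hunr 𝔓 h𝔓 σ hσ)

/-- **`ρ̄_{E,p} ⊗ k` is NOT unramified at an additive `v ∤ p`, `p ≥ 3`**, for any (injective) change of
coefficients `j : 𝔽_p → k` to a field (`FramedGaloisRep.isUnramifiedAt_baseChange_iff`).
[cite: SilvermanAEC2009, Thm. VII.6.1 and proof of Thm. VII.7.1 (PDF pp. 177–179)] -/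
theorem IsTorsionGaloisRep.not_isUnramifiedAt_baseChange_of_hasAdditiveReductionAt [W.IsElliptic]
    {v : HeightOneSpectrum (𝓞 K)} (hadd : W.HasAdditiveReductionAt v) {p : ℕ} [Fact p.Prime]
    (hp3 : 3 ≤ p) (hpv : (p : 𝓞 K) ∉ v.asIdeal) {ρ : FramedGaloisRep K (ZMod p) 2}
    (hρ : W.IsTorsionGaloisRep p ρ) {k : Type*} [Field k] [TopologicalSpace k] (j : ZMod p →+* k)
    (hj : Continuous j) :
    ¬ FramedGaloisRep.IsUnramifiedAt v (FramedRep.baseChange j hj ρ) := by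
  rw [FramedGaloisRep.isUnramifiedAt_baseChange_iff j hj j.injective v ρ]
  exact hρ.not_isUnramifiedAt_of_hasAdditiveReductionAt hadd hp3 hpv

end Ramified

/-! ### §2 Over `ℚ`: an additive prime `q ≠ p` divides the level of any newform carrying `E[p]` -/

section Level

/-- **Additive reduction at the rational prime `q` in the place currency.**  For `E/ℚ` elliptic and a
prime `q` at which `E` has neither good nor multiplicative reduction (`ℚ_q`/`ℤ_q` currency,
`HasGoodReductionAtPrime` / `HasMultiplicativeReductionAtPrime`), `E` has additive reduction at the
place `v` of `𝓞 ℚ` with `ℓ_v = q` (local trichotomy, Silverman *AEC* VII.5.1, and the tree's bridges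
`hasGoodReductionAtPrime_iff_hasGoodReductionAt_ringOfIntegers`,
`hasMultiplicativeReductionAtPrime_iff_hasMultiplicativeReductionAt_ringOfIntegers`).
[cite: SilvermanAEC2009, VII.5 Prop. 5.1] -/
theorem hasAdditiveReductionAt_of_not_good_of_not_mult (W : WeierstrassCurve ℚ) [W.IsElliptic]
    (v : HeightOneSpectrum (𝓞 ℚ))
    (hng : ¬ (haveI := Fact.mk (primesEquiv v).2; W.HasGoodReductionAtPrime (primesEquiv v)))
    (hnm : ¬ (haveI := Fact.mk (primesEquiv v).2;
      W.HasMultiplicativeReductionAtPrime (primesEquiv v))) :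
    W.HasAdditiveReductionAt v := by
  rcases W.hasGoodReductionAt_or_hasMultiplicativeReductionAt_or_hasAdditiveReductionAt v with
    h | h | h
  · exact absurd ((W.hasGoodReductionAtPrime_iff_hasGoodReductionAt_ringOfIntegers (v := v)).mpr h)
      hng
  · exact absurd
      ((W.hasMultiplicativeReductionAtPrime_iff_hasMultiplicativeReductionAt_ringOfIntegers v).mpr h)
      hnm
  · exact h

/-- **An additive prime `q ≠ p` of `E/ℚ` (`p ≥ 3`) divides the level of every newform carrying
`E[p] ⊗ k` away from `M p`.**  If `f ∈ S_w(Γ₁(M))` and `ρ̄ ⊗ k` (ρ̄ a framed model of `E[p]`, `j : 𝔽_p → k`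
a field extension) satisfy `IsGaloisRepOfNewform1Int f ι_f {ℓ ∣ M p} (ρ̄ ⊗ k)` — in particular `ρ̄ ⊗ k`
is unramified at every prime `ℓ ∤ M p` — then every prime `q ≠ p` at which `E` has ADDITIVE reduction
divides `M` (`E[p]` is ramified at `q`, §1).  Deligne–Serre / Ribet: the Galois representation of a
newform of level `M` is unramified outside `M ℓ`; Serre 1987 §1.2: the primes of `N(ρ̄)` are the
ramified ones. [cite: Serre1987, §1.2, (1.2.1)–(1.2.2)]
[cite: SilvermanAEC2009, Thm. VII.6.1 and proof of Thm. VII.7.1 (PDF pp. 177–179)] -/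
theorem dvd_of_isGaloisRepOfNewform1Int_of_hasAdditiveReductionAt (W : WeierstrassCurve ℚ)
    [W.IsElliptic] {p : ℕ} [Fact p.Prime] (hp3 : 3 ≤ p) {ρ : ModPGaloisRep ℚ (ZMod p) 2}
    (hρ : W.IsTorsionGaloisRep p ρ) {k : Type*} [Field k] [TopologicalSpace k] (j : ZMod p →+* k)
    (hj : Continuous j) {M : ℕ} [NeZero M] {w : ℤ} {f : CuspForm (Gamma1 M) w}
    {ιf : coeffCharIntegers f →+* k}
    (hgal : IsGaloisRepOfNewform1Int f ιf {ℓ | ℓ ∣ M * p} (FramedRep.baseChange j hj ρ))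
    {q : ℕ} (hq : q.Prime) (hqp : q ≠ p)
    (hng : ¬ (haveI := Fact.mk hq; W.HasGoodReductionAtPrime q))
    (hnm : ¬ (haveI := Fact.mk hq; W.HasMultiplicativeReductionAtPrime q)) :
    q ∣ M := by
  have hpp : p.Prime := Fact.out
  -- the place `v` of `ℚ` with `ℓ_v = q`
  obtain ⟨v, hv⟩ : ∃ v : HeightOneSpectrum (𝓞 ℚ), primesEquiv v = ⟨q, hq⟩ :=
    ⟨(primesEquiv (R := 𝓞 ℚ)).symm ⟨q, hq⟩, Equiv.apply_symm_apply _ _⟩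
  have hvq : ((primesEquiv v : Nat.Primes) : ℕ) = q := by rw [hv]
  have hadd : W.HasAdditiveReductionAt v := by
    refine W.hasAdditiveReductionAt_of_not_good_of_not_mult v ?_ ?_
    · rw [hv]; exact hng
    · rw [hv]; exact hnm
  have hpv : ((p : ℕ) : 𝓞 ℚ) ∉ v.asIdeal := by
    rw [natCast_mem_asIdeal_iff_primesEquiv_eq v hpp, hvq]
    exact hqp
  by_contra hqM
  have hvS : ((primesEquiv v : Nat.Primes) : ℕ) ∉ {ℓ | ℓ ∣ M * p} := by
    rw [hvq]
    intro h'
    rcases (Nat.Prime.dvd_mul hq).mp h' with h1 | h1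
    · exact hqM h1
    · exact hqp ((Nat.prime_dvd_prime_iff_eq hq hpp).mp h1)
  exact hρ.not_isUnramifiedAt_baseChange_of_hasAdditiveReductionAt hadd hp3 hpv j hj (hgal v hvS).1

end Level

/-! ### §3 The level-lowered newform for `E[p]`, `p` odd of good reduction -/

section LevelLowering

/-- **THE LEVEL-LOWERED NEWFORM (Ribet–Diamond) for `E[p]` at an ODD prime `p` of GOOD reduction.**
Let `E/ℚ` be an elliptic curve, `p ≠ 2` a prime of good reduction with `E[p]` irreducible, `ρ̄` a
framed model of `E[p]` and `ρ̄' = ρ̄ ⊗ 𝔽̄_p`.  GRANTED the Modularity Theorem (`hmod`: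
`exists_isNewformOf`, BCDT Thm. A) and Diamond's refined level lowering (`hLL`:
`diamond1995_refinedSerre`, Ribet 1990 Thm. 1.1 + Diamond 1995 Thm. 1.1, `ℓ` odd): there are a level
`M ∣ N(ρ̄')` (`serreLevel p ρ̄'`) with `p ∤ M`, all of whose prime factors are primes of BAD reduction of
`E`, divisible by every prime `q ≠ p` of ADDITIVE reduction of `E`, and a newform `f ∈ S₂(Γ₁(M))` with
`ρ̄' ≅ ρ̄_f` away from `M p` (`IsGaloisRepOfNewform1Int f ι_f {ℓ ∣ M p} ρ̄'`).  Proof (Serre's road,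
Duke 1987 §4.6, as in the tree's `ram_of_semistable_of_irr` Steps 1–4): `ρ̄'` is irreducible, odd,
modular; its Serre weight at the canonical datum above `p` is `2` (good reduction, `p ≠ 2`:
`serreWeight_eq_two_of_hasGoodReductionAt`); `hLL` gives `f` of weight `2` and level `M ∣ N(ρ̄')`;
a good prime `ℓ ≠ p` does not divide `N(ρ̄')` (`not_dvd_serreLevel_baseChange_of_hasGoodReductionAt_int`),
`p ∤ N(ρ̄')` (`not_dvd_serreLevel`), and the additive primes divide `M` by §2.
[cite: Diamond1995RefinedSerre, Thm. 1.1] [cite: Ribet1990, Thm. 1.1]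
[cite: Serre1987, §1.2, §2.8 Prop. 3–4, §4.6 Théorème 4] [cite: BCDTJAMS2001, Theorem A] -/
theorem exists_isNewform1_two_dvd_serreLevel_of_hasGoodReductionAtPrime
    (hmod : exists_isNewformOf) (hLL : diamond1995_refinedSerre)
    (W : WeierstrassCurve ℚ) [W.IsElliptic] (p : ℕ) [Fact p.Prime] (hp2 : p ≠ 2)
    (hgood : W.HasGoodReductionAtPrime p) (hirr : W.HasIrreducibleModPGaloisRep p)
    [TopologicalSpace (AlgebraicClosure (ZMod p))] [DiscreteTopology (AlgebraicClosure (ZMod p))]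
    {ρ : ModPGaloisRep ℚ (ZMod p) 2} (hρ : W.IsTorsionGaloisRep p ρ) :
    ∃ (M : ℕ) (_ : NeZero M),
      M ∣ serreLevel p (FramedRep.baseChange (algebraMap (ZMod p) (AlgebraicClosure (ZMod p)))
            continuous_of_discreteTopology ρ) ∧
      ¬ p ∣ M ∧
      (∀ q : ℕ, (hq : q.Prime) → q ∣ M → ¬ (haveI := Fact.mk hq; W.HasGoodReductionAtPrime q)) ∧
      (∀ q : ℕ, (hq : q.Prime) → q ≠ p →
        ¬ (haveI := Fact.mk hq; W.HasGoodReductionAtPrime q) →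
        ¬ (haveI := Fact.mk hq; W.HasMultiplicativeReductionAtPrime q) → q ∣ M) ∧
      ∃ (f : CuspForm (Gamma1 M) 2) (ιf : coeffCharIntegers f →+* AlgebraicClosure (ZMod p)),
        IsNewform1 f ∧ IsGaloisRepOfNewform1Int f ιf {q | q ∣ M * p}
          (FramedRep.baseChange (algebraMap (ZMod p) (AlgebraicClosure (ZMod p)))
            continuous_of_discreteTopology ρ) := by
  classical
  have hp : p.Prime := Fact.out
  have hodd : Odd p := hp.odd_of_ne_two hp2
  have hp3 : 3 ≤ p := by have := hp.two_le; omega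
  /- Step 1. `ρ̄' = ρ̄ ⊗ 𝔽̄_p`: irreducible and odd. -/
  haveI : NeZero ((p : ℕ) : ℚ) := ⟨by exact_mod_cast hp.ne_zero⟩
  set j : ZMod p →+* AlgebraicClosure (ZMod p) := algebraMap (ZMod p) (AlgebraicClosure (ZMod p))
    with hj
  set ρ' : ModPGaloisRep ℚ (AlgebraicClosure (ZMod p)) 2 :=
    FramedRep.baseChange j continuous_of_discreteTopology ρ with hρ'
  have habs := isAbsolutelyIrreducible_of_hasIrreducibleModPGaloisRep W hp2 hirr hρ
  have hirr' : ρ'.toGaloisRep.IsIrreducible := by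
    rw [← ModPGaloisRep.isIrreducible_iff_toGaloisRep]
    exact habs.isIrreducible_baseChange (AlgebraicClosure (ZMod p)) j _
  have hodd' : FramedGaloisRep.IsOdd ρ' :=
    (ModPGaloisRep.isOdd_of_det_eq_modPCyclotomicCharacterZMod ρ
      (W.det_eq_modPCyclotomicCharacter_of_isTorsionGaloisRep_holds p ρ hρ)).baseChange j _
  /- Step 2. `ρ̄` and `ρ̄'` are modular, `E` being modular (`hmod`). -/
  haveI : NeZero (W.conductorNorm ℤ) := ⟨(conductorNorm_pos_holds W).ne'⟩
  have hWmod : BCDT.IsModular W := exists_isNewformOf_iff.mp hmod W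
  have hρmod : ModPGaloisRep.IsModular ρ := hWmod.isModular_of_isTorsionGaloisRep'' hρ
  have hρ'mod : ModPGaloisRep.IsModular ρ' := hρmod.baseChange_algebraicClosure
  /- Step 3. The canonical local datum at the place `v` above `p`; the weight is `2` (good reduction). -/
  obtain ⟨v, hv⟩ : ∃ v : HeightOneSpectrum (𝓞 ℚ), primesEquiv v = ⟨p, hp⟩ :=
    ⟨(primesEquiv (R := 𝓞 ℚ)).symm ⟨p, hp⟩, Equiv.apply_symm_apply _ _⟩
  have hpv' : (p : 𝓞 ℚ) ∈ v.asIdeal := (natCast_mem_asIdeal_iff_primesEquiv_eq v hp).mpr (by rw [hv])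
  have hgoodv : W.HasGoodReductionAt v := by
    have h := WeierstrassCurve.hasGoodReductionAtPrime_iff_hasGoodReductionAt_ringOfIntegers (v := v) W
    rw [hv] at h
    exact h.mp hgood
  set loc : LocalRestrictionAt p ρ' :=
    { F := v.adicCompletion ℚ
      residueFieldCard_eq := residueFieldCard_adicCompletion_eq_of_natCast_mem hpv'
      irreducible_natCast := irreducible_natCast_valuativeInteger_adicCompletion_of_natCast_mem hpv'
      rep := FramedGaloisRep.restrictField (v.adicCompletion ℚ) ρ'
      rep_eq_restrictField := rfl } with hloc
  obtain ⟨ι⟩ := nonempty_ringHom_residue (k := AlgebraicClosure (ZMod p)) p (v.adicCompletion ℚ)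
    (residueFieldCard_adicCompletion_eq_of_natCast_mem hpv')
  have hw : (serreWeight p ρ' loc ι : ℤ) = 2 := by
    have h2 : serreWeight p ρ' loc ι = 2 :=
      serreWeight_eq_two_of_hasGoodReductionAt W p hp2 v hpv' hgoodv hρ (AlgebraicClosure (ZMod p))
        j ι
    rw [h2]; rfl
  /- Step 4. Level-lowering: `ρ̄'` arises from a newform `f` of weight `2` and level `M ∣ N(ρ̄')`. -/
  obtain ⟨M, hMz, hMN, f, ιf, hf, hgal⟩ :=
    hLL p hodd (AlgebraicClosure (ZMod p)) ρ' hirr' hodd' hρ'mod loc ι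
  revert hgal hf ιf f
  rw [hw]
  intro f ιf hf hgal
  haveI : NeZero M := hMz
  /- Step 5. The primes of `M`. -/
  have hpM : ¬ p ∣ M := fun h ↦ not_dvd_serreLevel p ρ' (h.trans hMN)
  have hbad : ∀ q : ℕ, (hq : q.Prime) → q ∣ M →
      ¬ (haveI := Fact.mk hq; W.HasGoodReductionAtPrime q) := by
    intro q hq hqM hgq
    have hqN : q ∣ serreLevel p ρ' := hqM.trans hMN
    have hqp : q ≠ p := by
      rintro rfl
      exact not_dvd_serreLevel q ρ' hqN
    obtain ⟨u, hu⟩ : ∃ u : HeightOneSpectrum ℤ, natGenerator u = q :=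
      ⟨(primesEquiv (R := ℤ)).symm ⟨q, hq⟩, Rat.natGenerator_primesEquiv_symm ⟨q, hq⟩⟩
    have hgu : W.HasGoodReductionAt u := by
      have h := W.hasGoodReductionAtPrime_primesEquiv_iff_hasGoodReductionAt u
      have hu' : primesEquiv (R := ℤ) u = ⟨q, hq⟩ := Subtype.ext hu
      rw [hu'] at h
      exact h.mp hgq
    exact not_dvd_serreLevel_baseChange_of_hasGoodReductionAt_int W p hρ j _ u
      (by rw [hu]; exact hqp) hgu (by rw [hu]; exact hqN)
  have haddM : ∀ q : ℕ, (hq : q.Prime) → q ≠ p →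
      ¬ (haveI := Fact.mk hq; W.HasGoodReductionAtPrime q) →
      ¬ (haveI := Fact.mk hq; W.HasMultiplicativeReductionAtPrime q) → q ∣ M :=
    fun q hq hqp hng hnm ↦
      W.dvd_of_isGaloisRepOfNewform1Int_of_hasAdditiveReductionAt hp3 hρ j _ hgal hq hqp hng hnm
  exact ⟨M, hMz, hMN, hpM, hbad, haddM, f, ιf, hf, hgal⟩

/-! ### §4 The `Γ₀(M)` form when `p ∤ φ(M)` -/

/-- **The level-lowered newform on `Γ₀(M)` when `p ∤ φ(M)`.**  In the situation of
`exists_isNewform1_two_dvd_serreLevel_of_hasGoodReductionAtPrime`, if the level `M` produced there has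
`p ∤ φ(M)`, the newform descends to `Γ₀(M)`: at every prime `ℓ ∤ M p N_E` the Frobenius polynomial of
`E[p]` is `X² − a_ℓ X + ℓ` (`charpoly_baseChange_of_isTorsionGaloisRep`), so `ε_f(ℓ) ≡ 1 (mod 𝔓)`, and a
character of `(ℤ/M)ˣ` (order dividing `φ(M)`, prime to `p`) congruent to `1` is `1`
(`nebentypus_apply_eq_one_of_map_coeff_zero_eq_of_not_dvd_totient`, Dirichlet
`nebentypus_eq_one_of_forall_prime`); then `f = g|Γ₁` for a `Γ₀(M)`-newform `g`
(`exists_isNewform0_coe_eq_of_nebentypus_eq_one`).  Stated as: for EVERY newform `f ∈ S₂(Γ₁(M))`,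
`p ∤ M φ(M)`… carrying `ρ̄'` away from `M p`, there is a `Γ₀(M)`-newform `g` with the same underlying
function.  (Carayol's lemma would remove `p ∤ φ(M)`; not claimed.)
[cite: Serre1987, §3.3 and §4.2] [cite: Diamond1995RefinedSerre, Thm. 1.1] -/
theorem exists_isNewform0_coe_eq_of_isGaloisRepOfNewform1Int_of_not_dvd_totient
    (W : WeierstrassCurve ℚ) [W.IsElliptic] {p : ℕ} [Fact p.Prime] {ρ : ModPGaloisRep ℚ (ZMod p) 2}
    (hρ : W.IsTorsionGaloisRep p ρ) {K : Type} [Field K] [CharP K p] [TopologicalSpace K]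
    [DiscreteTopology K] (j : ZMod p →+* K) {M : ℕ} [NeZero M] (hφ : ¬ p ∣ M.totient)
    {f : CuspForm (Gamma1 M) 2} (hf : IsNewform1 f) (ιf : coeffCharIntegers f →+* K)
    (hgal : IsGaloisRepOfNewform1Int f ιf {q | q ∣ M * p}
      (FramedRep.baseChange j continuous_of_discreteTopology ρ)) :
    ∃ g : CuspForm (Gamma0 M) 2, IsNewform0 g ∧ (⇑g : UpperHalfPlane → ℂ) = ⇑f := by
  classical
  have hp : p.Prime := Fact.out
  have hNE : 0 < W.conductorNorm ℤ := conductorNorm_pos_holds W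
  have hε : nebentypus f = 1 := by
    refine nebentypus_eq_one_of_forall_prime (max p (W.conductorNorm ℤ)) ?_
    intro q hq hqB hqN
    have hqp : q ≠ p := fun h' ↦ (lt_of_le_of_lt (le_max_left _ _) hqB).ne' h'
    have hqNE : ¬ q ∣ W.conductorNorm ℤ := fun h' ↦
      (lt_of_le_of_lt (le_max_right _ _) hqB).not_ge (Nat.le_of_dvd hNE h')
    obtain ⟨v, rfl⟩ : ∃ v : HeightOneSpectrum (𝓞 ℚ), (primesEquiv v : ℕ) = q :=
      ⟨primesEquiv.symm ⟨q, hq⟩, by rw [Equiv.apply_symm_apply]⟩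
    have hvS : ((primesEquiv v : Nat.Primes) : ℕ) ∉ {q | q ∣ M * p} := by
      intro h'
      rcases (Nat.Prime.dvd_mul hq).mp h' with h1 | h1
      · exact hqN h1
      · exact hqp ((Nat.prime_dvd_prime_iff_eq hq hp).mp h1)
    obtain ⟨-, P, hP, hch⟩ := hgal v hvS
    obtain ⟨𝔓, h𝔓⟩ := primesAbove_nonempty v
    obtain ⟨σ, hσ⟩ := exists_isArithFrobAt_of_mem_primesAbove_holds (v := v) h𝔓
    have hgood : W.HasGoodReductionAt v := by
      by_contra h'
      exact hqNE ((W.dvd_conductorNorm_iff v).mpr h')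
    have h1 := hch 𝔓 h𝔓 σ hσ
    rw [charpoly_baseChange_of_isTorsionGaloisRep W hρ j _ hqp hgood h𝔓 hσ] at h1
    have h2 := congrArg (fun Q : Polynomial K ↦ Q.coeff 0) h1
    simp only [Polynomial.coeff_map, coeff_add, coeff_sub, coeff_X_pow, coeff_C_mul,
      coeff_X_zero, coeff_C_zero] at h2
    have h0' : ιf (P.coeff 0) = ((primesEquiv v : ℕ) : K) := by
      rw [← h2]; simp
    exact nebentypus_apply_eq_one_of_map_coeff_zero_eq_of_not_dvd_totient hq hqN hP ιf hqp hφ h0'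
  obtain ⟨g, hg, hcoe⟩ := exists_isNewform0_coe_eq_of_nebentypus_eq_one hf hε
  exact ⟨g, hg, hcoe⟩

/-! ### §5 The `Γ₀(M)` form on the sub-population "every bad prime `r ≡ 1 (mod p)` is a `p`-carrier" -/

/-- `p ∤ φ(N)` when every prime `q ∣ N` has `q ≠ p` and `p ∤ q − 1` (`N ≠ 0`): Euler's product
`φ(N) = ∏_{q^k ∥ N} q^{k−1}(q − 1)` (`Nat.totient_eq_prod_factorization`).  (Private copy of the
bookkeeping lemma of `Summit.….NonSurjCornerSerreLevelExact.not_dvd_totient_of_forall_prime`, which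
lives in a Summits file this Literature module may not import.) [folklore] -/
private theorem not_dvd_totient_of_forall_prime_aux {p N : ℕ} (hp : p.Prime) (hN : N ≠ 0)
    (h : ∀ q : ℕ, q.Prime → q ∣ N → q ≠ p ∧ ¬ p ∣ q - 1) : ¬ p ∣ Nat.totient N := by
  rw [Nat.totient_eq_prod_factorization hN]
  refine hp.prime.not_dvd_finsuppProd fun q hq ↦ ?_
  have hqprime : q.Prime := Nat.prime_of_mem_primeFactors hq
  have hqN : q ∣ N := Nat.dvd_of_mem_primeFactors hq
  obtain ⟨hqp, hq1⟩ := h q hqprime hqN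
  intro hdvd
  rcases (Nat.Prime.dvd_mul hp).mp hdvd with h1 | h1
  · exact hqp ((Nat.prime_dvd_prime_iff_eq hp hqprime).mp (hp.dvd_of_dvd_pow h1)).symm
  · exact hq1 h1

/-- **THE LEVEL-LOWERED NEWFORM ON `Γ₀(M)` — trivial character WITHOUT Carayol's lemma, on the
sub-population "every bad prime `r ≡ 1 (mod p)` of `E` is a `p`-carrier".**  In the situation of
`exists_isNewform1_two_dvd_serreLevel_of_hasGoodReductionAtPrime` (`E/ℚ` globally minimal, `p ≠ 2` of
good reduction, `E[p]` irreducible; Modularity `hmod` and Diamond 1995 Thm. 1.1 `hLL` BY NAME), assume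
moreover (`hcar`) that every prime `r` of BAD reduction with `p ∣ r − 1` is a prime of MULTIPLICATIVE
reduction with `p ∣ v_r(Δ_min)` (so `E[p]` is unramified at `r`, Tate: `r ∤ N(ρ̄')`,
`not_dvd_serreLevel_baseChange_of_hasMultiplicativeReductionAt_of_dvd_int`).  Then the level `M` of
the level-lowered newform `f ∈ S₂(Γ₁(M))` has NO prime factor `≡ 1 (mod p)` (its primes are bad and
divide `N(ρ̄')`) and `p ∤ M`, so `p ∤ φ(M)` and `f` DESCENDS to a `Γ₀(M)`-newform `g` (same function
on `ℍ`; §4): the nebentypus, `≡ 1 (mod 𝔓)`, has order prime to `p`.  At `p = 3` this is the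
trivial-character clause of Darmon–Diamond–Taylor Thm. 3.15 / Diamond 1995 Cor. 6.5 for `ρ̄_{E,3}` on
the sub-population "no `ρ̄`-ramified bad prime `≡ 1 (mod 3)`" — e.g. the shadow primes `q ≡ 2 (mod 3)`
of line `shadow_seed` (crux `KobayashiLowerHalfLargeImage`) never obstruct — proved from Modularity +
Diamond Thm. 1.1 alone, without DDT 3.15 / Carayol.  Conclusion: `M ∣ N(ρ̄')`, `p ∤ M`, `p ∤ φ(M)`,
primes of `M` bad, additive primes `q ≠ p` divide `M`, `f ∈ S₂(Γ₁(M))` newform with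
`IsGaloisRepOfNewform1Int f ι_f {ℓ ∣ M p} ρ̄'`, and `g ∈ S₂(Γ₀(M))` newform with `⇑g = ⇑f`.
[cite: Diamond1995RefinedSerre, Thm. 1.1 and Cor. 6.5] [cite: DarmonDiamondTaylor1995, Thm. 3.15]
[cite: Serre1987, §1.2, §3.3, §4.6] [cite: Ribet1990, Thm. 1.1] -/
theorem exists_isNewform0_two_dvd_serreLevel_of_hasGoodReductionAtPrime_of_carrier
    (hmod : exists_isNewformOf) (hLL : diamond1995_refinedSerre)
    (W : WeierstrassCurve ℚ) [W.IsElliptic] [W.IsGloballyMinimal] (p : ℕ) [Fact p.Prime] (hp2 : p ≠ 2)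
    (hgood : W.HasGoodReductionAtPrime p) (hirr : W.HasIrreducibleModPGaloisRep p)
    (hcar : ∀ r : ℕ, (hr : r.Prime) → p ∣ r - 1 →
      ¬ (haveI := Fact.mk hr; W.HasGoodReductionAtPrime r) →
      (haveI := Fact.mk hr; W.HasMultiplicativeReductionAtPrime r) ∧
        p ∣ padicValInt r W.minimalDiscriminantInt)
    [TopologicalSpace (AlgebraicClosure (ZMod p))] [DiscreteTopology (AlgebraicClosure (ZMod p))]
    {ρ : ModPGaloisRep ℚ (ZMod p) 2} (hρ : W.IsTorsionGaloisRep p ρ) :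
    ∃ (M : ℕ) (_ : NeZero M),
      M ∣ serreLevel p (FramedRep.baseChange (algebraMap (ZMod p) (AlgebraicClosure (ZMod p)))
            continuous_of_discreteTopology ρ) ∧
      ¬ p ∣ M ∧ ¬ p ∣ M.totient ∧
      (∀ q : ℕ, (hq : q.Prime) → q ∣ M → ¬ (haveI := Fact.mk hq; W.HasGoodReductionAtPrime q)) ∧
      (∀ q : ℕ, (hq : q.Prime) → q ≠ p →
        ¬ (haveI := Fact.mk hq; W.HasGoodReductionAtPrime q) →
        ¬ (haveI := Fact.mk hq; W.HasMultiplicativeReductionAtPrime q) → q ∣ M) ∧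
      ∃ (f : CuspForm (Gamma1 M) 2) (ιf : coeffCharIntegers f →+* AlgebraicClosure (ZMod p)),
        IsNewform1 f ∧ IsGaloisRepOfNewform1Int f ιf {q | q ∣ M * p}
          (FramedRep.baseChange (algebraMap (ZMod p) (AlgebraicClosure (ZMod p)))
            continuous_of_discreteTopology ρ) ∧
        ∃ g : CuspForm (Gamma0 M) 2, IsNewform0 g ∧ (⇑g : UpperHalfPlane → ℂ) = ⇑f := by
  classical
  have hp : p.Prime := Fact.out
  obtain ⟨M, hMz, hMN, hpM, hbad, haddM, f, ιf, hf, hgal⟩ :=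
    W.exists_isNewform1_two_dvd_serreLevel_of_hasGoodReductionAtPrime hmod hLL p hp2 hgood hirr hρ
  haveI : NeZero M := hMz
  set j : ZMod p →+* AlgebraicClosure (ZMod p) := algebraMap (ZMod p) (AlgebraicClosure (ZMod p))
    with hj
  -- `ord_u Δ_min = v_r(Δ_min)` at every place `u` of `ℤ`
  have hordZ : ∀ u : HeightOneSpectrum ℤ,
      W.ordMinimalDiscriminant u = padicValInt (natGenerator u) W.minimalDiscriminantInt := by
    intro u
    rw [← W.factorization_minimalDiscriminantNorm_holds u,
      minimalDiscriminantNorm_int_eq_natAbs_minimalDiscriminantInt_holds W,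
      Nat.factorization_def _ (show (natGenerator u).Prime from (primesEquiv u).2)]
    rfl
  /- No prime of `M` is `≡ 1 (mod p)`: such a prime would be bad (primes of `M` are bad), hence a
  `p`-carrier by `hcar`, hence unramified for `E[p]` and prime to `N(ρ̄') ⊇ M`. -/
  have hφ : ¬ p ∣ M.totient := by
    refine not_dvd_totient_of_forall_prime_aux hp hMz.out fun r hr hrM ↦ ⟨?_, fun hpr ↦ ?_⟩
    · rintro rfl; exact hpM hrM
    · have hrp : r ≠ p := by rintro rfl; exact hpM hrM
      obtain ⟨hmult, hval⟩ := hcar r hr hpr (hbad r hr hrM)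
      obtain ⟨u, hu⟩ : ∃ u : HeightOneSpectrum ℤ, natGenerator u = r :=
        ⟨(primesEquiv (R := ℤ)).symm ⟨r, hr⟩, Rat.natGenerator_primesEquiv_symm ⟨r, hr⟩⟩
      have hu' : primesEquiv (R := ℤ) u = ⟨r, hr⟩ := Subtype.ext hu
      have hmu : W.HasMultiplicativeReductionAt u := by
        have h := W.hasMultiplicativeReductionAtPrime_primesEquiv_iff_hasMultiplicativeReductionAt u
        rw [hu'] at h
        exact h.mp hmult
      have hord : p ∣ W.ordMinimalDiscriminant u := by rw [hordZ u, hu]; exact hval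
      exact not_dvd_serreLevel_baseChange_of_hasMultiplicativeReductionAt_of_dvd_int W p hρ j _ u
        (by rw [hu]; exact hrp) hmu hord (by rw [hu]; exact hrM.trans hMN)
  obtain ⟨g, hg, hcoe⟩ :=
    W.exists_isNewform0_coe_eq_of_isGaloisRepOfNewform1Int_of_not_dvd_totient hρ j hφ hf ιf hgal
  exact ⟨M, hMz, hMN, hpM, hφ, hbad, haddM, f, ιf, hf, hgal, g, hg, hcoe⟩

end LevelLowering

end WeierstrassCurve

end
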